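import Literature.Geometry.Kaehler.SiegelTorusThetaDivisorSingular
import HarnessLib

/-!
# Even two-division points on `Θ` are singular points of `Θ`: `θ_null ⊂ N₀`

Layer `Literature/Geometry/Kaehler`, namespace `Literature.Geometry.Kaehler.ComplexTorus` (lane
`lit-hodgefound`, Layer A4, theta-divisor row A4-17; prover seat `lit-hodgefound-p23`, row «A4-17(k)»).
Sequel of `SiegelTorusThetaDivisorSingular.lean` (`thetaDivisorSing` = `Sing Θ`, Grushevsky's `g + 1`
equations) and of `SiegelTorusThetaParity.lean` (`ϑ[k/2; l/2](·, Ω)` is an even / odd function according to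
the parity of `ᵗkl`; the odd two-division points lie on `Θ`; `#X₂^± = 2^{n-1}(2ⁿ ± 1)`).

Sources followed (held texts, read at the quoted chunks).

* H. Lange, *Abelian Varieties over the Complex Numbers* (2023), §2.3.4 Prop. 2.3.14 [held p0105–p0106]:
  for a symmetric divisor `D` with `𝒪_X(D) = L(H, χ)` and `x = λ̄ ∈ X₂`,
  "`(−1)^{mult_x(D)} = χ(λ)(−1)^{mult_0(D)}`", proved through "`ϑ(−v) = (−1)^{mult_0(D)} ϑ(v)`" and
  "`(−1)^{mult_x(D)} ϑ̃(v) = ϑ̃(−v)`"; "`X₂^+(D) = {x ∈ X₂ ∣ mult_x(D) ≡ 0 (mod 2)}`". For the even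
  symmetric divisor `Θ = (ϑ)` of `X_Ω` this says: at an EVEN two-division point the multiplicity of `Θ` is
  even — so an even two-division point ON `Θ` has multiplicity `≥ 2`, i.e. lies on `Sing Θ`.
* S. Grushevsky, *The Schottky problem* (MSRI Publ. 59, 2012), §5 [held `paper:arxiv-1009.0369` p0011]:
  "`θ_null,g := {τ ∣ ∏_{m ∈ A[2]^even} θ_m(τ) = 0} = {(A, Θ) ∈ 𝒜_g ∣ A[2]^even ∩ Θ ≠ ∅}`"; the locus
  `N_{0,g}` of p.p.a.v. with `Sing Θ ≠ ∅` "has two irreducible components, scheme-theoretically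
  `N_{0,g} = θ_null,g + 2N'_{0,g}`" (Debarre), and Thm 5.6 speaks of "the double point singularity of the
  theta divisor" at `m ∈ A[2]^even ∩ Θ`.
* D. Mumford, *Tata Lectures on Theta I*, Ch. II §1: `θ[a;b](−z) = θ[−a;−b](z)`, parity of `θ_m`.
* E. T. Whittaker, G. N. Watson, *A Course of Modern Analysis*, §21.12, §21.41: the zeros of `ϑ₁, …, ϑ₄`
  (so the even null values `ϑ₂(0), ϑ₃(0), ϑ₄(0)` are non-zero).

What is here (theorems only; no definition, no named fact, net debt `0`).

* `riemannThetaChar_singular_zero_iff` — the singularity of `Θ` at `π(Ωa + b)` read in characteristic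
  `[a; b]`: `(ϑ[a;b](0) = 0 ∧ dϑ[a;b](0) = 0) ↔ (ϑ(Ωa + b) = 0 ∧ dϑ(Ωa + b) = 0)` (the reduction
  `ϑ[a;b](z) = e(z) ϑ(z + Ωa + b)` with a nowhere-vanishing exponential `e`).
* **`fderiv_riemannThetaChar_half_zero_of_even`** — `ᵗkl` even ⇒ `dϑ[k/2; l/2](·, Ω)(0) = 0` (an even
  holomorphic function has vanishing differential at the origin), hence
  **`fderiv_riemannTheta_halfPeriod_eq_zero_of_even`**: if `ϑ` vanishes at an even half-period
  `½(Ωk + l)` then so does `dϑ` — `riemannTheta_singular_halfPeriod_iff_of_even`.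
* Torus level: **`proj_half_mem_thetaDivisorSing_iff_of_even`** — for an EVEN two-division point
  `x = π(½m)` of `X_Ω`: `x ∈ Sing Θ ↔ x ∈ Θ` (Prop. 2.3.14: `mult_x Θ` is even);
  `coe_mem_thetaDivisorSing_iff_of_not_odd` (the same on the subtype `X₂ = Ker 2_X`);
  **`exists_even_twoTorsion_mem_thetaDivisor_iff`** — Grushevsky's `θ_null`:
  "`A[2]^even ∩ Θ ≠ ∅` ↔ `A[2]^even ∩ Sing Θ ≠ ∅`", and `thetaDivisorSing_nonempty_of_even_mem`
  (`θ_null ⊂ N₀`).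
* Consequences for a p.p.a.v. with `Sing Θ = ∅`: **`natCard_twoTorsion_inter_thetaDivisor_of_thetaDivisorSing_eq_empty`**
  — `Θ` passes through EXACTLY the `2^{n-1}(2ⁿ − 1)` odd two-division points;
  `riemannThetaChar_half_zero_ne_zero_of_even` — no even theta-null vanishes; genus one
  (`Sing Θ = ∅` always, `thetaDivisorSing_fin_one_eq_empty`): `natCard_twoTorsion_inter_thetaDivisor_fin_one`
  (`#(X₂ ∩ Θ) = 1` on an elliptic curve) and `riemannThetaChar_half_zero_ne_zero_of_even_fin_one`
  (the even thetanullwerte `ϑ[0;0](0,τ), ϑ[½;0](0,τ), ϑ[0;½](0,τ)` — Jacobi's `ϑ₃, ϑ₂, ϑ₄` null values — are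
  non-zero).

Not here: multiplicities `≥ 3`, the Hessian / rank of the tangent cone at an even point (Grushevsky
Thm 5.6–5.7), `Θ` reduced, the divisor `θ_null ⊂ 𝒜_g` as a modular form, `N₀ = θ_null ∪ N₀'`.

## References

* [Lange2023AbelianVarietiesComplex] H. Lange, Abelian Varieties over the Complex Numbers (2023),
  §2.3.4 Prop. 2.3.14, Prop. 2.3.15.
* [Grushevsky2012SchottkyProblem] S. Grushevsky, The Schottky problem, MSRI Publ. 59 (2012), §5.
* [MumfordTata1] D. Mumford, Tata Lectures on Theta I, Ch. II §1.
* [WhittakerWatson1927] E. T. Whittaker, G. N. Watson, A Course of Modern Analysis, §21.12, §21.41.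
-/

noncomputable section

open scoped Manifold Topology
open scoped Real
open Set Function Complex Matrix
open Literature.Analysis.SpecialFunctions

namespace Literature.Geometry.Kaehler

namespace ComplexTorus

/-! ### Calculus: an even differentiable function has vanishing differential at the origin -/

section Even

variable {E : Type*} [NormedAddCommGroup E] [NormedSpace ℂ E]

/-- An even function `f : E → ℂ` which is differentiable at `0` has `df(0) = 0`
(`df(0) = df(0) ∘ (−id)` by the chain rule). [folklore] -/
private theorem fderiv_zero_eq_zero_of_forall_neg {f : E → ℂ} (heven : ∀ x, f (-x) = f x)
    (hf : DifferentiableAt ℂ f 0) : fderiv ℂ f 0 = 0 := by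
  have hneg : HasFDerivAt (fun x : E ↦ -x) (-(ContinuousLinearMap.id ℂ E)) 0 :=
    (hasFDerivAt_id (𝕜 := ℂ) (0 : E)).neg
  have hf0 : HasFDerivAt f (fderiv ℂ f 0) (-(0 : E)) := by
    rw [neg_zero]
    exact hf.hasFDerivAt
  have hcomp := hf0.comp (0 : E) hneg
  have hfe : (f ∘ fun x : E ↦ -x) = f := funext fun x ↦ heven x
  rw [hfe] at hcomp
  have huniq := hcomp.unique hf.hasFDerivAt
  ext v
  have hv := congrArg (fun L : E →L[ℂ] ℂ ↦ L v) huniq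
  simp only [ContinuousLinearMap.coe_comp, Function.comp_apply, _root_.neg_apply,
    ContinuousLinearMap.coe_id', id_eq, map_neg] at hv
  have h2 : (2 : ℂ) * fderiv ℂ f 0 v = 0 := by linear_combination -hv
  simpa using h2

end Even

/-! ### Even theta constants: `dϑ[k/2; l/2](·, Ω)(0) = 0`; singularity of `Θ` at an even half-period -/

section ThetaChar

variable {n : ℕ} (Ω : Matrix (Fin n) (Fin n) ℂ) (hΩ : ∀ i j, Ω i j = Ω j i)
  {c : ℝ} (hc : 0 < c) (hY : ∀ x : Fin n → ℝ, c * ∑ i, x i ^ 2 ≤ ∑ i, ∑ j, x i * (Ω i j).im * x j)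

include hΩ hc hY in
/-- **The singularity of `Θ` at `π(Ωa + b)` read in characteristic `[a; b]`**: since
`ϑ[a;b](z, Ω) = e(z) · ϑ(z + Ωa + b, Ω)` with the nowhere-vanishing factor
`e(z) = exp(πi ᵗaΩa + 2πi ᵗa(z + b))` (`riemannThetaChar_eq_cexp_mul_riemannTheta`),
`ϑ[a;b]` vanishes together with its differential at `0` iff `ϑ` vanishes together with its differential at
`Ωa + b` ("`mult_x(D) = mult_0(t_x^*D)`"). [cite: Lange2023AbelianVarietiesComplex, §2.3.4 Prop. 2.3.14 (proof, p0106)]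
[cite: MumfordTata1, Ch. II §1] -/
theorem riemannThetaChar_singular_zero_iff (a b : Fin n → ℂ) :
    (riemannThetaChar a b Ω 0 = 0 ∧ fderiv ℂ (riemannThetaChar a b Ω) 0 = 0) ↔
      (riemannTheta Ω (Ω *ᵥ a + b) = 0 ∧ fderiv ℂ (riemannTheta Ω) (Ω *ᵥ a + b) = 0) := by
  -- the (nowhere-vanishing) exponential factor, kept opaque
  obtain ⟨e, he⟩ : ∃ e : (Fin n → ℂ) → ℂ,
      e = fun z ↦ cexp (π * I * (a ⬝ᵥ (Ω *ᵥ a)) + 2 * π * I * (a ⬝ᵥ (z + b))) := ⟨_, rfl⟩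
  have he_diff : Differentiable ℂ e := by
    have hlin : Differentiable ℂ fun z : Fin n → ℂ ↦ a ⬝ᵥ (z + b) := by
      simp only [dotProduct, Pi.add_apply]
      fun_prop
    rw [he]
    exact ((hlin.const_mul (2 * π * I)).const_add (π * I * (a ⬝ᵥ (Ω *ᵥ a)))).cexp
  have he0 : e 0 ≠ 0 := by
    rw [he]
    exact Complex.exp_ne_zero _
  have hchar : riemannThetaChar a b Ω = e * fun z ↦ riemannTheta Ω (z + (Ω *ᵥ a + b)) := by
    funext z
    rw [Pi.mul_apply, riemannThetaChar_eq_cexp_mul_riemannTheta Ω hΩ a b z, add_assoc, he]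
  have hg : HasFDerivAt (fun z : Fin n → ℂ ↦ riemannTheta Ω (z + (Ω *ᵥ a + b)))
      (fderiv ℂ (riemannTheta Ω) (Ω *ᵥ a + b)) 0 := by
    rw [hasFDerivAt_comp_add_right, zero_add]
    exact ((differentiable_riemannTheta Ω hc hY) _).hasFDerivAt
  have hprod := (he_diff 0).hasFDerivAt.mul hg
  have hval : riemannThetaChar a b Ω 0 = e 0 * riemannTheta Ω (Ω *ᵥ a + b) := by
    rw [hchar, Pi.mul_apply, zero_add]
  have hder : ∀ v, fderiv ℂ (riemannThetaChar a b Ω) 0 v =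
      e 0 * fderiv ℂ (riemannTheta Ω) (Ω *ᵥ a + b) v +
        riemannTheta Ω (Ω *ᵥ a + b) * fderiv ℂ e 0 v := by
    intro v
    rw [hchar, hprod.fderiv]
    simp only [_root_.add_apply, _root_.smul_apply, smul_eq_mul, zero_add]
  constructor
  · rintro ⟨h0, hd⟩
    have hϑ : riemannTheta Ω (Ω *ᵥ a + b) = 0 := by
      rw [hval] at h0
      exact (mul_eq_zero.1 h0).resolve_left he0
    refine ⟨hϑ, ?_⟩
    ext v
    have hv := hder v
    rw [hd, hϑ, zero_mul, add_zero, _root_.zero_apply] at hv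
    exact (mul_eq_zero.1 hv.symm).resolve_left he0
  · rintro ⟨hϑ, hd⟩
    refine ⟨by rw [hval, hϑ, mul_zero], ?_⟩
    ext v
    rw [hder v, hd, hϑ, _root_.zero_apply, mul_zero, zero_mul, add_zero]

include hΩ hc hY in
/-- **The differential of an even theta function vanishes at the origin**: for `k, l ∈ ℤⁿ` with `ᵗkl`
even, `ϑ[k/2; l/2](·, Ω)` is an even function (`riemannThetaChar_half_neg_of_even`, Mumford's parity /
Lange's "`(−1)^{mult_x(D)} ϑ̃(v) = ϑ̃(−v)`"), so `dϑ[k/2; l/2](·, Ω)(0) = 0` — its multiplicity at `0`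
is even. [cite: Lange2023AbelianVarietiesComplex, §2.3.4 Prop. 2.3.14 (p0105–p0106)]
[cite: MumfordTata1, Ch. II §1] -/
theorem fderiv_riemannThetaChar_half_zero_of_even (k l : Fin n → ℤ) (h : Even (k ⬝ᵥ l)) :
    fderiv ℂ (riemannThetaChar (fun i ↦ (k i : ℂ) / 2) (fun i ↦ (l i : ℂ) / 2) Ω) 0 = 0 :=
  fderiv_zero_eq_zero_of_forall_neg (fun z ↦ riemannThetaChar_half_neg_of_even k l Ω z h)
    ((differentiable_riemannThetaChar Ω hΩ hc hY _ _) 0)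

include hΩ hc hY in
/-- **An even half-period on `{ϑ = 0}` is a singular point of `{ϑ = 0}`**: for `k, l ∈ ℤⁿ` with `ᵗkl`
even, if `ϑ(½(Ωk + l), Ω) = 0` then `dϑ(·, Ω)(½(Ωk + l)) = 0` — the multiplicity of the even symmetric
divisor `Θ = (ϑ)` at the even two-division point `π(½(Ωk + l))` is even (Prop. 2.3.14), hence `≥ 2` as
soon as it is positive. [cite: Lange2023AbelianVarietiesComplex, §2.3.4 Prop. 2.3.14 (p0105–p0106)]
[cite: Grushevsky2012SchottkyProblem, §5 (held p0011)] -/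
theorem fderiv_riemannTheta_halfPeriod_eq_zero_of_even (k l : Fin n → ℤ) (h : Even (k ⬝ᵥ l))
    (h0 : riemannTheta Ω (Ω *ᵥ (fun i ↦ (k i : ℂ) / 2) + fun i ↦ (l i : ℂ) / 2) = 0) :
    fderiv ℂ (riemannTheta Ω) (Ω *ᵥ (fun i ↦ (k i : ℂ) / 2) + fun i ↦ (l i : ℂ) / 2) = 0 := by
  refine ((riemannThetaChar_singular_zero_iff Ω hΩ hc hY _ _).1 ⟨?_, ?_⟩).2
  · rw [riemannThetaChar_eq_cexp_mul_riemannTheta Ω hΩ]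
    simp only [zero_add, h0, mul_zero]
  · exact fderiv_riemannThetaChar_half_zero_of_even Ω hΩ hc hY k l h

include hΩ hc hY in
/-- At an even half-period `w = ½(Ωk + l)` (`ᵗkl` even): `(ϑ(w) = 0 ∧ dϑ(w) = 0) ↔ ϑ(w) = 0`.
[cite: Lange2023AbelianVarietiesComplex, §2.3.4 Prop. 2.3.14 (p0105–p0106)] -/
theorem riemannTheta_singular_halfPeriod_iff_of_even (k l : Fin n → ℤ) (h : Even (k ⬝ᵥ l)) :
    (riemannTheta Ω (Ω *ᵥ (fun i ↦ (k i : ℂ) / 2) + fun i ↦ (l i : ℂ) / 2) = 0 ∧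
        fderiv ℂ (riemannTheta Ω) (Ω *ᵥ (fun i ↦ (k i : ℂ) / 2) + fun i ↦ (l i : ℂ) / 2) = 0) ↔
      riemannTheta Ω (Ω *ᵥ (fun i ↦ (k i : ℂ) / 2) + fun i ↦ (l i : ℂ) / 2) = 0 :=
  ⟨And.left, fun h0 ↦ ⟨h0, fderiv_riemannTheta_halfPeriod_eq_zero_of_even Ω hΩ hc hY k l h h0⟩⟩

end ThetaChar

/-! ### The principally polarised Siegel torus: even two-division points on `Θ` lie on `Sing Θ` -/

section SiegelTorus

variable {n : ℕ} (Ω : Matrix (Fin n) (Fin n) ℂ) (hΩ : ∀ i j, Ω i j = Ω j i)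
  (hpos : (Matrix.of fun i j => (Ω i j).im).PosDef)
  (Φ : (Fin n ⊕ Fin n → ℝ) ≃L[ℝ] (Fin n → ℂ))
  (hΦ : ∀ v i, Φ v i = (v (Sum.inl i) : ℂ) + ∑ j, Ω i j * (v (Sum.inr j) : ℂ))

/-- **An even two-division point of `X_Ω` lies on `Sing Θ` iff it lies on `Θ`** (Prop. 2.3.14 for the even
symmetric divisor `Θ`: `mult_x(Θ) ≡ 0 (mod 2)` at `x ∈ X₂^+`, so `mult_x(Θ) ≥ 1 ⇒ mult_x(Θ) ≥ 2`): for
lattice coordinates `m = (l, k) ∈ ℤⁿ ⊕ ℤⁿ` with `Σᵢ lᵢkᵢ` even, `π(½m) ∈ Sing Θ ↔ π(½m) ∈ Θ`.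
[cite: Lange2023AbelianVarietiesComplex, §2.3.4 Prop. 2.3.14 (p0105–p0106)]
[cite: Grushevsky2012SchottkyProblem, §5 (held p0011)] -/
theorem proj_half_mem_thetaDivisorSing_iff_of_even (m : Fin n ⊕ Fin n → ℤ)
    (heven : Even (∑ i, m (Sum.inl i) * m (Sum.inr i))) :
    proj Φ (fun i ↦ (m i : ℝ) / 2) ∈ thetaDivisorSing Ω hΩ hpos Φ hΦ ↔
      proj Φ (fun i ↦ (m i : ℝ) / 2) ∈ thetaDivisor Ω hΩ hpos Φ hΦ := by
  obtain ⟨c, hc, hY⟩ := exists_pos_mul_sum_sq_le_of_posDef_im Ω hpos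
  rw [proj_half_eq_cover Ω Φ hΦ m, cover_mem_thetaDivisorSing_iff Ω hΩ hpos Φ hΦ,
    cover_mem_thetaDivisor_iff]
  refine riemannTheta_singular_halfPeriod_iff_of_even Ω hΩ hc hY _ _ ?_
  simpa only [dotProduct, mul_comm] using heven

/-- A two-division point which is not an odd point `π(½(Ωk + l))`, `ᵗkl` odd, is an even one: it is
`π(½m)` for some `m = (l, k)` with `Σ lᵢkᵢ` even (every point of `X₂ = ½Λ/Λ` is a `π(½m)`).
[cite: Lange2023AbelianVarietiesComplex, §1.1.2 Prop. 1.1.14 and §2.3.4 Prop. 2.3.14] -/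
theorem exists_eq_proj_half_and_even_of_not_odd
    (x : (mapMatrixHom Φ Φ ((2 : ℤ) • (1 : Matrix (Fin n ⊕ Fin n) (Fin n ⊕ Fin n) ℤ))).ker)
    (hx : ¬ ∃ m : Fin n ⊕ Fin n → ℤ, (x : ComplexTorus Φ) = proj Φ (fun i ↦ (m i : ℝ) / 2) ∧
      Odd (∑ i, m (Sum.inl i) * m (Sum.inr i))) :
    ∃ m : Fin n ⊕ Fin n → ℤ, (x : ComplexTorus Φ) = proj Φ (fun i ↦ (m i : ℝ) / 2) ∧
      Even (∑ i, m (Sum.inl i) * m (Sum.inr i)) := by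
  have h2 : (2 : ℤ) ≠ 0 := two_ne_zero
  obtain ⟨m₀, hm₀⟩ := kerLatticeHomRestrict_surjective Φ Φ (det_smul_one_ne_zero h2) x
  have hx₀ : (x : ComplexTorus Φ) = proj Φ (fun i ↦ (m₀ i : ℝ) / 2) := by
    rw [← hm₀, coe_kerLatticeHomRestrict_smul_one Φ h2 m₀]
    simp only [Int.cast_ofNat]
  rcases Int.even_or_odd (∑ i, m₀ (Sum.inl i) * m₀ (Sum.inr i)) with h | h
  · exact ⟨m₀, hx₀, h⟩
  · exact absurd ⟨m₀, hx₀, h⟩ hx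

/-- **On `X₂ = Ker 2_X`: an EVEN two-division point lies on `Sing Θ` iff it lies on `Θ`.**
[cite: Lange2023AbelianVarietiesComplex, §2.3.4 Prop. 2.3.14 (p0105–p0106)]
[cite: Grushevsky2012SchottkyProblem, §5 (held p0011)] -/
theorem coe_mem_thetaDivisorSing_iff_of_not_odd
    (x : (mapMatrixHom Φ Φ ((2 : ℤ) • (1 : Matrix (Fin n ⊕ Fin n) (Fin n ⊕ Fin n) ℤ))).ker)
    (hx : ¬ ∃ m : Fin n ⊕ Fin n → ℤ, (x : ComplexTorus Φ) = proj Φ (fun i ↦ (m i : ℝ) / 2) ∧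
      Odd (∑ i, m (Sum.inl i) * m (Sum.inr i))) :
    (x : ComplexTorus Φ) ∈ thetaDivisorSing Ω hΩ hpos Φ hΦ ↔
      (x : ComplexTorus Φ) ∈ thetaDivisor Ω hΩ hpos Φ hΦ := by
  obtain ⟨m, hxm, heven⟩ := exists_eq_proj_half_and_even_of_not_odd Φ x hx
  rw [hxm]
  exact proj_half_mem_thetaDivisorSing_iff_of_even Ω hΩ hpos Φ hΦ m heven

/-- **`θ_null ⊂ N₀`**: an even two-division point on `Θ` is a point of `Sing Θ`; in particular `Sing Θ ≠ ∅`.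
[cite: Grushevsky2012SchottkyProblem, §5 (held p0011)]
[cite: Lange2023AbelianVarietiesComplex, §2.3.4 Prop. 2.3.14 (p0105–p0106)] -/
theorem thetaDivisorSing_nonempty_of_even_mem
    (x : (mapMatrixHom Φ Φ ((2 : ℤ) • (1 : Matrix (Fin n ⊕ Fin n) (Fin n ⊕ Fin n) ℤ))).ker)
    (hx : ¬ ∃ m : Fin n ⊕ Fin n → ℤ, (x : ComplexTorus Φ) = proj Φ (fun i ↦ (m i : ℝ) / 2) ∧
      Odd (∑ i, m (Sum.inl i) * m (Sum.inr i)))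
    (hΘ : (x : ComplexTorus Φ) ∈ thetaDivisor Ω hΩ hpos Φ hΦ) :
    (thetaDivisorSing Ω hΩ hpos Φ hΦ).Nonempty :=
  ⟨x, (coe_mem_thetaDivisorSing_iff_of_not_odd Ω hΩ hpos Φ hΦ x hx).2 hΘ⟩

/-- **Grushevsky's `θ_null`** ("`θ_null,g = {(A, Θ) ∣ A[2]^even ∩ Θ ≠ ∅}`", the locus where an even
theta constant `θ_m(τ, 0)` vanishes) **is the locus where `Θ` is singular at an even two-division point**:
`A[2]^even ∩ Θ ≠ ∅ ↔ A[2]^even ∩ Sing Θ ≠ ∅`. [cite: Grushevsky2012SchottkyProblem, §5 (held p0011)]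
[cite: Lange2023AbelianVarietiesComplex, §2.3.4 Prop. 2.3.14 (p0105–p0106)] -/
theorem exists_even_twoTorsion_mem_thetaDivisor_iff :
    (∃ x : (mapMatrixHom Φ Φ ((2 : ℤ) • (1 : Matrix (Fin n ⊕ Fin n) (Fin n ⊕ Fin n) ℤ))).ker,
      (¬ ∃ m : Fin n ⊕ Fin n → ℤ, (x : ComplexTorus Φ) = proj Φ (fun i ↦ (m i : ℝ) / 2) ∧
          Odd (∑ i, m (Sum.inl i) * m (Sum.inr i))) ∧
        (x : ComplexTorus Φ) ∈ thetaDivisor Ω hΩ hpos Φ hΦ) ↔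
    (∃ x : (mapMatrixHom Φ Φ ((2 : ℤ) • (1 : Matrix (Fin n ⊕ Fin n) (Fin n ⊕ Fin n) ℤ))).ker,
      (¬ ∃ m : Fin n ⊕ Fin n → ℤ, (x : ComplexTorus Φ) = proj Φ (fun i ↦ (m i : ℝ) / 2) ∧
          Odd (∑ i, m (Sum.inl i) * m (Sum.inr i))) ∧
        (x : ComplexTorus Φ) ∈ thetaDivisorSing Ω hΩ hpos Φ hΦ) := by
  refine exists_congr fun x ↦ and_congr_right fun hx ↦ ?_
  exact (coe_mem_thetaDivisorSing_iff_of_not_odd Ω hΩ hpos Φ hΦ x hx).symm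

/-- **A p.p.a.v. with smooth theta divisor has no vanishing even theta-null, so `Θ` passes through EXACTLY
the `2^{n-1}(2ⁿ − 1)` odd two-division points** (`n ≥ 1`; `(A, Θ) ∉ N₀ ⇒ (A, Θ) ∉ θ_null`; Lange
Prop. 2.3.15 (a)(i) / Ex. 2.3.7 (4)(c): `#X₂^−(Θ) = 2^{g−1}(2^g − 1)`).
[cite: Grushevsky2012SchottkyProblem, §5 (held p0011)]
[cite: Lange2023AbelianVarietiesComplex, §2.3.4 Prop. 2.3.14–2.3.15 (p0105–p0106)] -/
theorem natCard_twoTorsion_inter_thetaDivisor_of_thetaDivisorSing_eq_empty (hn : 0 < n)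
    (hS : thetaDivisorSing Ω hΩ hpos Φ hΦ = ∅) :
    Nat.card {x : (mapMatrixHom Φ Φ ((2 : ℤ) • (1 : Matrix (Fin n ⊕ Fin n) (Fin n ⊕ Fin n) ℤ))).ker //
        (x : ComplexTorus Φ) ∈ thetaDivisor Ω hΩ hpos Φ hΦ} = 2 ^ (n - 1) * (2 ^ n - 1) := by
  rw [← natCard_twoTorsion_odd Φ hn]
  refine Nat.card_congr (Equiv.subtypeEquivRight fun x ↦ ⟨fun hΘ ↦ ?_, ?_⟩)
  · by_contra hx
    have hmem := (coe_mem_thetaDivisorSing_iff_of_not_odd Ω hΩ hpos Φ hΦ x hx).2 hΘ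
    rw [hS] at hmem
    exact hmem
  · rintro ⟨m, hxm, hodd⟩
    rw [hxm]
    exact proj_half_mem_thetaDivisor_of_odd Ω hΩ hpos Φ hΦ m hodd

include hpos hΦ in
/-- **No even theta-null of a p.p.a.v. with `Sing Θ = ∅` vanishes**: `ϑ[k/2; l/2](0, Ω) ≠ 0` for all
`k, l ∈ ℤⁿ` with `ᵗkl` even. [cite: Grushevsky2012SchottkyProblem, §5 (held p0011)]
[cite: Lange2023AbelianVarietiesComplex, §2.3.4 Prop. 2.3.14 (p0105–p0106)] -/
theorem riemannThetaChar_half_zero_ne_zero_of_even (hS : thetaDivisorSing Ω hΩ hpos Φ hΦ = ∅)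
    (k l : Fin n → ℤ) (h : Even (k ⬝ᵥ l)) :
    riemannThetaChar (fun i ↦ (k i : ℂ) / 2) (fun i ↦ (l i : ℂ) / 2) Ω 0 ≠ 0 := by
  obtain ⟨c, hc, hY⟩ := exists_pos_mul_sum_sq_le_of_posDef_im Ω hpos
  intro h0
  have hsing := (riemannThetaChar_singular_zero_iff Ω hΩ hc hY _ _).1
    ⟨h0, fderiv_riemannThetaChar_half_zero_of_even Ω hΩ hc hY k l h⟩
  have hmem : cover Φ (Ω *ᵥ (fun i ↦ (k i : ℂ) / 2) + fun i ↦ (l i : ℂ) / 2) ∈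
      thetaDivisorSing Ω hΩ hpos Φ hΦ :=
    (cover_mem_thetaDivisorSing_iff Ω hΩ hpos Φ hΦ _).2 hsing
  rw [hS] at hmem
  exact hmem

end SiegelTorus

/-! ### Genus one: `#(X₂ ∩ Θ) = 1`; the even thetanullwerte are non-zero -/

section DimOne

variable (Ω : Matrix (Fin 1) (Fin 1) ℂ) (hΩ : ∀ i j, Ω i j = Ω j i)
  (hpos : (Matrix.of fun i j => (Ω i j).im).PosDef)
  (Φ : (Fin 1 ⊕ Fin 1 → ℝ) ≃L[ℝ] (Fin 1 → ℂ))
  (hΦ : ∀ v i, Φ v i = (v (Sum.inl i) : ℂ) + ∑ j, Ω i j * (v (Sum.inr j) : ℂ))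

/-- **An elliptic curve `X_τ = ℂ/(ℤ + τℤ)`: exactly ONE of its four two-division points lies on `Θ`** — the
odd one `π(½(1 + τ))` (`Sing Θ = ∅`, `thetaDivisorSing_fin_one_eq_empty`; `2⁰(2¹ − 1) = 1`).
[cite: Lange2023AbelianVarietiesComplex, §2.3.4 Prop. 2.3.15 (p0106)] [cite: WhittakerWatson1927, §21.12] -/
theorem natCard_twoTorsion_inter_thetaDivisor_fin_one :
    Nat.card {x : (mapMatrixHom Φ Φ ((2 : ℤ) • (1 : Matrix (Fin 1 ⊕ Fin 1) (Fin 1 ⊕ Fin 1) ℤ))).ker //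
        (x : ComplexTorus Φ) ∈ thetaDivisor Ω hΩ hpos Φ hΦ} = 1 := by
  rw [natCard_twoTorsion_inter_thetaDivisor_of_thetaDivisorSing_eq_empty Ω hΩ hpos Φ hΦ one_pos
    (thetaDivisorSing_fin_one_eq_empty Ω hΩ hpos Φ hΦ)]
  norm_num

include hΩ hpos in
/-- **The even thetanullwerte of an elliptic curve are non-zero**: `ϑ[k/2; l/2](0, τ) ≠ 0` for `k, l ∈ ℤ`
with `kl` even — Jacobi's `ϑ₃(0|τ) = ϑ[0;0]`, `ϑ₂(0|τ) = ϑ[½;0]`, `ϑ₄(0|τ) = ϑ[0;½]` (up to the integral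
shifts of the characteristic) do not vanish on the upper half plane (`ϑ(·, τ)` has only simple zeros,
`not_riemannTheta_singular_fin_one`). [cite: WhittakerWatson1927, §21.12 and §21.41]
[cite: MumfordTata1, Ch. I §4–§5 and Ch. II §1] -/
theorem riemannThetaChar_half_zero_ne_zero_of_even_fin_one (k l : Fin 1 → ℤ) (h : Even (k ⬝ᵥ l)) :
    riemannThetaChar (fun i ↦ (k i : ℂ) / 2) (fun i ↦ (l i : ℂ) / 2) Ω 0 ≠ 0 := by
  obtain ⟨c, hc, hY⟩ := exists_pos_mul_sum_sq_le_of_posDef_im Ω hpos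
  intro h0
  exact not_riemannTheta_singular_fin_one Ω hpos _
    ((riemannThetaChar_singular_zero_iff Ω hΩ hc hY _ _).1
      ⟨h0, fderiv_riemannThetaChar_half_zero_of_even Ω hΩ hc hY k l h⟩)

end DimOne

end ComplexTorus

end Literature.Geometry.Kaehler

end
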